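import Mathlib.Data.Fin.Tuple.Sort
import Summits.ValiantsHypothesis.ValiantsHypothesis.Theorems.RigidityForcesSymmetryGrenetFirstOrderRankRigidBlockIIExtraPrelim

/-!
# Route RigidityForcesSymmetry — `GrenetFirstOrderRankRigid` (item stmt-ValiantsHypothesis-21029),
line `grenet_gauge`: stub `stub_linearRigid`, step 5 (block II) — the design permutations

For the crux line `Cruxes/GrenetFirstOrderRankRigid/Lines/grenet_gauge.lean` (blueprint
`Lines/grenet_gauge-stub_linearRigid-PROOF.md`, §5, block II; NOTES "TYPE II FORMAL PLAN").
Existence of the orderings of `Fin n` underlying the designs E1, E2, E3 of an overlap block: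
an ordering with prescribed nested prefix sets exists for every chain `S₁ ⊆ S₂ ⊆ S₃ ⊆ S₄`
(`exists_perm_prefix_chain`, by sorting a rank function), whence `exists_perm_designE1/E2/E3`.
No new definitions.  VP ≠ VNP is not moved by this file.
-/

open Finset

namespace Summit.ValiantsHypothesis.Theorems.RigidityForcesSymmetry.GrenetGauge

open Literature.Computability.AlgebraicComplexity

variable {n : ℕ}

/-- **Sorting by a rank function.**  For every `key : Fin n → ℕ` there is an ordering `π` of `Fin n`
all of whose sublevel sets `{key < i}` are prefix sets: `π({c < |{key < i}|}) = {key < i}`. [folklore] -/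
theorem exists_perm_prefixes (key : Fin n → ℕ) :
    ∃ π : Equiv.Perm (Fin n), ∀ i : ℕ,
      (univ.filter fun c : Fin n => (c : ℕ) < (univ.filter fun x : Fin n => key x < i).card).image π
        = univ.filter fun x : Fin n => key x < i := by
  classical
  refine ⟨Tuple.sort key, fun i => ?_⟩
  have hmono : Monotone (key ∘ Tuple.sort key) := Tuple.monotone_sort key
  have himg : ∀ D : Finset (Fin n), D.image (Tuple.sort key) = univ.filter (fun x : Fin n => key x < i) ↔
      D = univ.filter fun c : Fin n => key (Tuple.sort key c) < i := by
    intro D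
    constructor
    · intro h
      ext c
      simp only [Finset.mem_filter, Finset.mem_univ, true_and]
      constructor
      · intro hc
        have : Tuple.sort key c ∈ D.image (Tuple.sort key) := Finset.mem_image_of_mem _ hc
        rw [h] at this
        exact (Finset.mem_filter.mp this).2
      · intro hc
        have : Tuple.sort key c ∈ D.image (Tuple.sort key) := by
          rw [h]; exact Finset.mem_filter.mpr ⟨Finset.mem_univ _, hc⟩
        obtain ⟨c', hc', hcc⟩ := Finset.mem_image.mp this
        rwa [← (Tuple.sort key).injective hcc]
    · rintro rfl
      ext x
      simp only [Finset.mem_image, Finset.mem_filter, Finset.mem_univ, true_and]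
      constructor
      · rintro ⟨c, hc, rfl⟩; exact hc
      · intro hx
        exact ⟨(Tuple.sort key).symm x, by rw [Equiv.apply_symm_apply]; exact hx, Equiv.apply_symm_apply _ x⟩
  -- the preimage `D` of the sublevel set is down-closed of the right size, hence a prefix
  have hD : (univ.filter fun c : Fin n => key (Tuple.sort key c) < i).card
      = (univ.filter fun x : Fin n => key x < i).card := by
    rw [← Finset.card_image_of_injective _ (Tuple.sort key).injective, (himg _).mpr rfl]
  have hsub : (univ.filter fun c : Fin n => key (Tuple.sort key c) < i)
      ⊆ univ.filter fun c : Fin n => (c : ℕ) < (univ.filter fun x : Fin n => key x < i).card := by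
    intro c hc
    simp only [Finset.mem_filter, Finset.mem_univ, true_and] at hc ⊢
    by_contra hcs
    have h1 : (univ.filter fun c' : Fin n => (c' : ℕ) < (c : ℕ) + 1)
        ⊆ univ.filter fun c : Fin n => key (Tuple.sort key c) < i := by
      intro c' hc'
      simp only [Finset.mem_filter, Finset.mem_univ, true_and] at hc' ⊢
      exact lt_of_le_of_lt (hmono (show c' ≤ c from Nat.lt_succ_iff.mp hc')) hc
    have h2 := Finset.card_le_card h1
    rw [hD, Fin.card_filter_val_lt] at h2
    have := c.isLt
    omega
  rw [himg]
  symm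
  exact Finset.eq_of_subset_of_card_le hsub (by rw [hD, Fin.card_filter_val_lt]; omega)

/-- **Orderings with a prescribed chain of prefix sets.**  For `S₁ ⊆ S₂ ⊆ S₃ ⊆ S₄` there is an
ordering of `Fin n` whose prefixes of lengths `|S₁|, |S₂|, |S₃|, |S₄|` are these sets. [folklore] -/
theorem exists_perm_prefix_chain (S₁ S₂ S₃ S₄ : Finset (Fin n)) (h12 : S₁ ⊆ S₂) (h23 : S₂ ⊆ S₃)
    (h34 : S₃ ⊆ S₄) :
    ∃ π : Equiv.Perm (Fin n),
      (univ.filter fun c : Fin n => (c : ℕ) < S₁.card).image π = S₁ ∧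
      (univ.filter fun c : Fin n => (c : ℕ) < S₂.card).image π = S₂ ∧
      (univ.filter fun c : Fin n => (c : ℕ) < S₃.card).image π = S₃ ∧
      (univ.filter fun c : Fin n => (c : ℕ) < S₄.card).image π = S₄ := by
  classical
  set key : Fin n → ℕ := fun x =>
    if x ∈ S₁ then 0 else if x ∈ S₂ then 1 else if x ∈ S₃ then 2 else if x ∈ S₄ then 3 else 4 with hkey
  obtain ⟨π, hπ⟩ := exists_perm_prefixes key
  have hlev : ∀ (i : ℕ) (S : Finset (Fin n)), (∀ x, key x < i ↔ x ∈ S) →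
      (univ.filter fun c : Fin n => (c : ℕ) < S.card).image π = S := by
    intro i S hS
    have hS' : (univ.filter fun x : Fin n => key x < i) = S := by
      ext x; simp only [Finset.mem_filter, Finset.mem_univ, true_and]; exact hS x
    have := hπ i
    rwa [hS'] at this
  refine ⟨π, hlev 1 S₁ fun x => ?_, hlev 2 S₂ fun x => ?_, hlev 3 S₃ fun x => ?_, hlev 4 S₄ fun x => ?_⟩ <;>
    simp only [hkey] <;> split_ifs with h1 h2 h3 h4 <;>
    first
    | exact iff_of_true (by omega) h1
    | exact iff_of_true (by omega) (h12 h1)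
    | exact iff_of_true (by omega) (h23 (h12 h1))
    | exact iff_of_true (by omega) (h34 (h23 (h12 h1)))
    | exact iff_of_true (by omega) h2
    | exact iff_of_true (by omega) (h23 h2)
    | exact iff_of_true (by omega) (h34 (h23 h2))
    | exact iff_of_true (by omega) h3
    | exact iff_of_true (by omega) (h34 h3)
    | exact iff_of_true (by omega) h4
    | exact iff_of_false (by omega) h1
    | exact iff_of_false (by omega) h2
    | exact iff_of_false (by omega) h3
    | exact iff_of_false (by omega) h4

/-- The new letter of a longer prefix: if `insert a P = Q` with `a ∉ P` then `a ∈ Q \ P`. [folklore] -/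
theorem mem_sdiff_of_insert_eq {α : Type*} [DecidableEq α] {a : α} {P Q : Finset α}
    (h : insert a P = Q) (ha : a ∉ P) : a ∈ Q \ P :=
  Finset.mem_sdiff.mpr ⟨h ▸ Finset.mem_insert_self a P, ha⟩

/-- **The E1 ordering** `[C₀ | α_f … α_l | rest]`: prefix `C₀`, then the block `A` read from `α_f` to
`α_l` (`α_f ≠ α_l`, or `|A| = 1` and `α_f = α_l`). [folklore] -/
theorem exists_perm_designE1 (A C₀ : Finset (Fin n)) (hC : C₀ ⊆ Aᶜ) {αf αl : Fin n} (hαf : αf ∈ A)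
    (hαl : αl ∈ A) (hne : αf ≠ αl ∨ A.card = 1) {k₀ u : ℕ} (hk : C₀.card = k₀) (huA : A.card + k₀ = u)
    (hkn : k₀ < n) (hul : u - 1 < n) :
    ∃ π : Equiv.Perm (Fin n),
      (univ.filter fun c : Fin n => (c : ℕ) < k₀).image π = C₀ ∧
      (univ.filter fun c : Fin n => k₀ ≤ (c : ℕ) ∧ (c : ℕ) < u).image π = A ∧
      π ⟨k₀, hkn⟩ = αf ∧ π ⟨u - 1, hul⟩ = αl := by
  have hdisj : Disjoint A C₀ := Finset.disjoint_left.mpr fun x hxA hxC => (Finset.mem_compl.mp (hC hxC)) hxA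
  have hαfC : αf ∉ C₀ := fun h => Finset.disjoint_left.mp hdisj hαf h
  have hαlC : αl ∉ C₀ := fun h => Finset.disjoint_left.mp hdisj hαl h
  have hc2 : (insert αf C₀).card = k₀ + 1 := by rw [Finset.card_insert_of_notMem hαfC, hk]
  have hc4 : (C₀ ∪ A).card = u := by rw [Finset.card_union_of_disjoint hdisj.symm, hk]; omega
  have h12 : C₀ ⊆ insert αf C₀ := Finset.subset_insert _ _
  have h24 : insert αf C₀ ⊆ C₀ ∪ A :=
    Finset.insert_subset (Finset.mem_union_right _ hαf) Finset.subset_union_left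
  rcases hne with hne | h1
  · -- `α_f ≠ α_l`: the chain `C₀ ⊆ C₀ + α_f ⊆ C₀ ∪ (A - α_l) ⊆ C₀ ∪ A`
    have h23 : insert αf C₀ ⊆ C₀ ∪ A.erase αl :=
      Finset.insert_subset (Finset.mem_union_right _ (Finset.mem_erase.mpr ⟨hne, hαf⟩)) Finset.subset_union_left
    have h34 : C₀ ∪ A.erase αl ⊆ C₀ ∪ A := Finset.union_subset_union le_rfl (Finset.erase_subset _ _)
    have hc3 : (C₀ ∪ A.erase αl).card = u - 1 := by
      rw [Finset.card_union_of_disjoint (Finset.disjoint_of_subset_right (Finset.erase_subset _ _) hdisj.symm),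
        hk, Finset.card_erase_of_mem hαl]
      have := Finset.card_pos.mpr ⟨αl, hαl⟩; omega
    obtain ⟨π, hp1, hp2, hp3, hp4⟩ := exists_perm_prefix_chain _ _ _ _ h12 h23 h34
    rw [hk] at hp1; rw [hc2] at hp2; rw [hc3] at hp3; rw [hc4] at hp4
    have hu1 : 0 < u := by have := Finset.card_pos.mpr ⟨αf, hαf⟩; omega
    refine ⟨π, hp1, ?_, ?_, ?_⟩
    · rw [permSlice_eq_sdiff π (by omega), hp4, hp1, Finset.union_sdiff_left, Finset.sdiff_eq_self_iff_disjoint]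
      exact hdisj
    · have h := Grenet.prefix_image_succ π hkn
      rw [hp2, hp1] at h
      have := mem_sdiff_of_insert_eq h.symm (by rw [← hp1]; exact Grenet.not_mem_prefix_image_self π ⟨k₀, hkn⟩)
      rw [Finset.mem_sdiff, Finset.mem_insert] at this
      exact this.1.resolve_right this.2
    · have h := Grenet.prefix_image_succ π hul
      simp only [Nat.sub_add_cancel hu1] at h
      rw [hp4, hp3] at h
      have := mem_sdiff_of_insert_eq h.symm (by rw [← hp3]; exact Grenet.not_mem_prefix_image_self π ⟨u - 1, hul⟩)
      rw [Finset.mem_sdiff, Finset.mem_union, Finset.mem_union, not_or, Finset.mem_erase, not_and'] at this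
      obtain ⟨h1 | h1, h2, h3⟩ := this
      · exact absurd h1 h2
      · by_contra hne'
        exact h3 h1 hne'
  · -- `|A| = 1`: `α_f = α_l`, the chain `C₀ ⊆ C₀ + α_f = C₀ ∪ A`
    obtain ⟨a, ha⟩ := Finset.card_eq_one.mp h1
    have hαf' : αf = a := by rw [ha] at hαf; exact Finset.mem_singleton.mp hαf
    have hαl' : αl = a := by rw [ha] at hαl; exact Finset.mem_singleton.mp hαl
    have hu : u = k₀ + 1 := by omega
    have hAe : C₀ ∪ A = insert αf C₀ := by
      rw [ha, hαf', Finset.union_comm]; rfl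
    obtain ⟨π, hp1, hp2, -, -⟩ := exists_perm_prefix_chain _ _ _ _ h12 h24 le_rfl
    rw [hk] at hp1; rw [hc2] at hp2
    have hπk : π ⟨k₀, hkn⟩ = αf := by
      have h := Grenet.prefix_image_succ π hkn
      rw [hp2, hp1] at h
      have := mem_sdiff_of_insert_eq h.symm (by rw [← hp1]; exact Grenet.not_mem_prefix_image_self π ⟨k₀, hkn⟩)
      rw [Finset.mem_sdiff, Finset.mem_insert] at this
      exact this.1.resolve_right this.2
    refine ⟨π, hp1, ?_, hπk, ?_⟩
    · rw [permSlice_eq_sdiff π (by omega), hu, hp2, hp1, ← hAe, Finset.union_sdiff_left,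
        Finset.sdiff_eq_self_iff_disjoint]
      exact hdisj
    · rw [show (⟨u - 1, hul⟩ : Fin n) = ⟨k₀, hkn⟩ from Fin.ext (by simp only; omega), hπk, hαf', hαl']

/-- **The E2 ordering** `[(C - φ) + αₐ | A - αₐ | φ | rest]`. [folklore] -/
theorem exists_perm_designE2 (A C : Finset (Fin n)) (hCA : C ⊆ Aᶜ) {φ αₐ : Fin n} (hφ : φ ∈ C)
    (hαₐ : αₐ ∈ A) {k₀ u : ℕ} (hCk : C.card = k₀) (huA : A.card + k₀ = u) :
    ∃ (π : Equiv.Perm (Fin n)) (c₁ : Fin n), (c₁ : ℕ) < k₀ ∧ π c₁ = αₐ ∧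
      (univ.filter fun c : Fin n => (c : ℕ) < k₀).image π = insert αₐ (C.erase φ) ∧
      (univ.filter fun c : Fin n => (c : ℕ) < u - 1).image π = (A ∪ C).erase φ ∧
      (univ.filter fun c : Fin n => (c : ℕ) < u).image π = A ∪ C := by
  have hdisj : Disjoint A C := Finset.disjoint_left.mpr fun x hxA hxC => (Finset.mem_compl.mp (hCA hxC)) hxA
  have hαC : αₐ ∉ C := fun h => Finset.disjoint_left.mp hdisj hαₐ h
  have hφA : φ ∉ A := fun h => Finset.disjoint_left.mp hdisj h hφ
  have hφα : αₐ ≠ φ := fun h => hφA (h ▸ hαₐ)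
  have hc1 : (insert αₐ (C.erase φ)).card = k₀ := by
    rw [Finset.card_insert_of_notMem (fun h => hαC (Finset.mem_of_mem_erase h)), Finset.card_erase_of_mem hφ, hCk]
    have := Finset.card_pos.mpr ⟨φ, hφ⟩; omega
  have hc3 : (A ∪ C).card = u := by rw [Finset.card_union_of_disjoint hdisj, hCk, huA]
  have hc2 : ((A ∪ C).erase φ).card = u - 1 := by
    rw [Finset.card_erase_of_mem (Finset.mem_union_right _ hφ), hc3]
  have h12 : insert αₐ (C.erase φ) ⊆ (A ∪ C).erase φ :=
    Finset.insert_subset (Finset.mem_erase.mpr ⟨hφα, Finset.mem_union_left _ hαₐ⟩)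
      (Finset.erase_subset_erase _ Finset.subset_union_right)
  have h23 : (A ∪ C).erase φ ⊆ A ∪ C := Finset.erase_subset _ _
  obtain ⟨π, hp1, hp2, hp3, -⟩ := exists_perm_prefix_chain _ _ _ _ h12 h23 le_rfl
  rw [hc1] at hp1; rw [hc2] at hp2; rw [hc3] at hp3
  refine ⟨π, π.symm αₐ, ?_, π.apply_symm_apply αₐ, hp1, hp2, hp3⟩
  rw [← Grenet.mem_prefix_image, hp1]
  exact Finset.mem_insert_self _ _

/-- **The E3 ordering** `[C | φ' | A - α₁ | α₁ | rest]`. [folklore] -/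
theorem exists_perm_designE3 (A C : Finset (Fin n)) (hCA : C ⊆ Aᶜ) {φ' α₁ : Fin n} (hφ'A : φ' ∉ A)
    (hφ'C : φ' ∉ C) (hα₁ : α₁ ∈ A) {k₀ u : ℕ} (hCk : C.card = k₀) (huA : A.card + k₀ = u)
    (hkn : k₀ < n) (hun : u < n) :
    ∃ π : Equiv.Perm (Fin n), π ⟨k₀, hkn⟩ = φ' ∧ π ⟨u, hun⟩ = α₁ ∧
      (univ.filter fun c : Fin n => (c : ℕ) < k₀).image π = C ∧
      (univ.filter fun c : Fin n => (c : ℕ) < k₀ + 1).image π = insert φ' C ∧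
      (univ.filter fun c : Fin n => (c : ℕ) < u).image π = insert φ' (C ∪ A.erase α₁) := by
  have hdisj : Disjoint A C := Finset.disjoint_left.mpr fun x hxA hxC => (Finset.mem_compl.mp (hCA hxC)) hxA
  have hα₁C : α₁ ∉ C := fun h => Finset.disjoint_left.mp hdisj hα₁ h
  have hc2 : (insert φ' C).card = k₀ + 1 := by rw [Finset.card_insert_of_notMem hφ'C, hCk]
  have hφ'3 : φ' ∉ C ∪ A.erase α₁ := fun h => (Finset.mem_union.mp h).elim hφ'C
    (fun h' => hφ'A (Finset.mem_of_mem_erase h'))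
  have hφ'4 : φ' ∉ C ∪ A := fun h => (Finset.mem_union.mp h).elim hφ'C hφ'A
  have hc3 : (insert φ' (C ∪ A.erase α₁)).card = u := by
    rw [Finset.card_insert_of_notMem hφ'3,
      Finset.card_union_of_disjoint (Finset.disjoint_of_subset_right (Finset.erase_subset _ _) hdisj.symm), hCk,
      Finset.card_erase_of_mem hα₁]
    have := Finset.card_pos.mpr ⟨α₁, hα₁⟩; omega
  have hc4 : (insert φ' (C ∪ A)).card = u + 1 := by
    rw [Finset.card_insert_of_notMem hφ'4, Finset.card_union_of_disjoint hdisj.symm, hCk]; omega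
  have h12 : C ⊆ insert φ' C := Finset.subset_insert _ _
  have h23 : insert φ' C ⊆ insert φ' (C ∪ A.erase α₁) :=
    Finset.insert_subset_insert _ Finset.subset_union_left
  have h34 : insert φ' (C ∪ A.erase α₁) ⊆ insert φ' (C ∪ A) :=
    Finset.insert_subset_insert _ (Finset.union_subset_union le_rfl (Finset.erase_subset _ _))
  obtain ⟨π, hp1, hp2, hp3, hp4⟩ := exists_perm_prefix_chain _ _ _ _ h12 h23 h34
  rw [hCk] at hp1; rw [hc2] at hp2; rw [hc3] at hp3; rw [hc4] at hp4
  refine ⟨π, ?_, ?_, hp1, hp2, hp3⟩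
  · have h := Grenet.prefix_image_succ π hkn
    rw [hp2, hp1] at h
    have := mem_sdiff_of_insert_eq h.symm (by rw [← hp1]; exact Grenet.not_mem_prefix_image_self π ⟨k₀, hkn⟩)
    rw [Finset.mem_sdiff, Finset.mem_insert] at this
    exact this.1.resolve_right this.2
  · have h := Grenet.prefix_image_succ π hun
    rw [hp4, hp3] at h
    have := mem_sdiff_of_insert_eq h.symm (by rw [← hp3]; exact Grenet.not_mem_prefix_image_self π ⟨u, hun⟩)
    rw [Finset.mem_sdiff, Finset.mem_insert, Finset.mem_insert, not_or, Finset.mem_union, Finset.mem_union, not_or,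
      Finset.mem_erase, not_and'] at this
    obtain ⟨h1 | h1 | h1, h2, h3, h4⟩ := this
    · exact absurd h1 h2
    · exact absurd h1 h3
    · by_contra hne
      exact h4 h1 hne

end Summit.ValiantsHypothesis.Theorems.RigidityForcesSymmetry.GrenetGauge
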